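import Summits.ResolutionOfSingularities.ResolutionOfSingularities.Theorems.WildConesCampaignW46AtomGerm
import Literature.RingTheory.MvPowerSeries.FiniteColength
import Literature.RingTheory.MvPowerSeries.OptionEquivLeft
import Literature.AlgebraicGeometry.Resolution.AdicNoetherian
import HarnessLib

/-!
# [OURS · L1 W4.6, rungs (i)/(ii) — the dictionary, SCHEME HALF, brick 3] `Isol` IS «isolated singularity»:
# the Milnor-type predicate of route `WildCones` is finiteness of the Tjurina algebra of the atom germ
# `z^p − a(u)` in the completed local ring `κ⟦z,u⟧`

Cell res-hironaka (LADDER-RESOLUTION rung L, D-0089), slot W4.6, seat res-L1-s46-pv-2 (gen 2). Host: route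
`WildCones`, crux `ClassicalRegimes` (stmt-ResolutionOfSingularities-16884), `--supports … --as helper`.

HONEST FRAMING. Everything here is OURS — theorems about route `WildCones`' typed coefficient calculus
(`Theorems/WildConesClassicalRegimesDefs.lean`: `jac`, `Isol`) and elementary power-series algebra; NOTHING
here is a statement of H. Hironaka's manuscript [Hironaka2017] and nothing of it is used; no FACT-LIST premise.
AI review is weaker than expert review.

## Statement

Let `κ` be a field of characteristic `p` (a prime), `c` a state, `a = ser c ∈ κ⟦u⟧` its cleaned series,
`J = jac c = (∂a/∂u_1, …, ∂a/∂u_n)`, and `f = z^p − a(u) ∈ κ⟦z,u⟧ = MvPowerSeries (Option (Fin n)) κ` the atom germ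
(`u`-series placed by `rename some`). The TJURINA IDEAL of `f` is `(f, ∂f/∂z, ∂f/∂u_k) = (f) + J·κ⟦z,u⟧`
(`∂f/∂z = p z^{p−1} = 0` in characteristic `p`, `∂f/∂u_k = −∂a/∂u_k`; this identification, with the tree's formal
partial derivative `Literature.RingTheory.MvPowerSeries.pd`, is the companion file `…AtomGermTjurinaIdeal.lean`,
`tjurina_eq`); this file works with `(f) + J·κ⟦z,u⟧` directly.

**Theorem** (`isol_iff_finite_tjurina`). `Isol c` (`κ⟦u⟧/J` finite over `κ`) **iff** the Tjurina algebra
`κ⟦z,u⟧ / ((f) + J κ⟦z,u⟧)` is finite over `κ` — i.e. iff the formal hypersurface germ `z^p = a(u)` has an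
ISOLATED SINGULARITY in the usual (Tjurina-number) sense.

* (⇒, `finite_tjurina_of_isol`) `𝔪^N ≤ J` for some `N` (`Jets.exists_maximalIdeal_pow_le_of_finite_quotient`);
  then `𝔪̂^{pN+N} ≤ (f) + J κ⟦z,u⟧`: a monomial `z^k u^d` of that degree has `|d| ≥ N` (so `u^d ∈ J`) or
  `k ≥ pN`, and `z^{pN} ≡ a^N ∈ 𝔪^N ≤ J` modulo `f`.
* (⇐, `isol_of_finite_tjurina`) the contraction of the Tjurina ideal to `κ⟦u⟧` is EXACTLY `J`
  (`comap_tjurina_eq`): if `g(u) = h·(z^p − a) + j` with `j ∈ J κ⟦z,u⟧`, slicing by powers of `z`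
  (`optionEquivLeft : κ⟦z,u⟧ ≅ κ⟦u⟧⟦z⟧`) gives `h_m ≡ a·h_{m+p}` modulo `J`, hence `h_m ∈ ⋂_N (J + 𝔪^N) = J`
  (Krull's intersection theorem in `κ⟦u⟧/J`), and `g = −a h_0 + j_0 ∈ J`; so `κ⟦u⟧/J ↪ κ⟦z,u⟧/Tjurina`.

With bricks 1–2 (`…FormalChart`, `…AtomGerm`) this completes the GERM-LEVEL dictionary: `MultP` = «order ≥ p»,
`Isol` = «isolated singularity», `step` = «controlled transform under the point blow-up, read in recognised formal
coordinates». What is still NOT here: the passage from the SCHEME `Z′` of the typed `CampaignW46.Step` to these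
completed local rings (ring-level chart facts, completion base change, non-rational points).

References: route file `Theses/WildCones.lean`; `Literature/RingTheory/MvPowerSeries/{MaximalIdealPow,FiniteColength,
OptionEquivLeft}.lean`; Mathlib `Ideal.iInf_pow_eq_bot_of_isLocalRing` (Krull); G.-M. Greuel,
C. Lossen, E. Shustin, *Introduction to Singularities and Deformations* (2007), §I.1–I.2 (Tjurina algebra, isolated
hypersurface singularities ⟺ finite Tjurina number). [GreuelLossenShustin2007] [folklore]
-/

noncomputable section

-- single-problem summit: the doubled namespace component `ResolutionOfSingularities` is forced
set_option linter.dupNamespace false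

open scoped BigOperators Classical
open MvPowerSeries IsLocalRing

namespace Summit.ResolutionOfSingularities.ResolutionOfSingularities.Theorems

namespace CampaignW46.AtomGerm

open WildCones
open Literature.RingTheory.MvPowerSeries (optionEquivLeft coeff_coeff_optionEquivLeft optionEquivLeft_X_none)
open Literature.RingTheory.MvPowerSeries.Jets (mem_maximalIdeal_pow_iff monomial_mem_maximalIdeal_pow
  maximalIdeal_pow_eq_span_monomial finite_quotient_maximalIdeal_pow exists_maximalIdeal_pow_le_of_finite_quotient
  mem_maximalIdeal_iff_constantCoeff_eq_zero)

variable {n : ℕ} {κ : Type} [Field κ] {p : ℕ}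

/-! ## Slicing `κ⟦z,u⟧ ≅ κ⟦u⟧⟦z⟧` by powers of `z` -/

/-- The exponent `(0, d)` is the placement of `d` along `some`. [folklore] -/
theorem optionElim_zero_eq_embDomain (d : Fin n →₀ ℕ) :
    d.optionElim 0 = Finsupp.embDomain ⟨some, Option.some_injective _⟩ d := by
  ext o
  cases o with
  | none =>
    rw [Finsupp.optionElim_apply_none, Finsupp.embDomain_notin_range]
    rintro ⟨j, hj⟩
    exact Option.some_ne_none j hj
  | some j => rw [Finsupp.optionElim_apply_some]; exact (Finsupp.embDomain_apply_self _ d j).symm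

/-- **Placed `u`-series are the constants of `κ⟦u⟧⟦z⟧`.** [folklore] -/
theorem optionEquivLeft_rename_some (g : MvPowerSeries (Fin n) κ) :
    optionEquivLeft (rename (some : Fin n → Option (Fin n)) g) = PowerSeries.C g := by
  ext k d
  rw [coeff_coeff_optionEquivLeft, PowerSeries.coeff_C]
  by_cases hk : k = 0
  · subst hk
    rw [if_pos rfl, optionElim_zero_eq_embDomain,
      show (rename (some : Fin n → Option (Fin n)) g) =
        rename (⟨some, Option.some_injective _⟩ : Fin n ↪ Option (Fin n)) g from rfl, coeff_embDomain_rename]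
  · rw [if_neg hk]
    apply coeff_rename_eq_zero
    rintro ⟨e, he⟩
    apply hk
    have h0 := congrArg (fun x : Option (Fin n) →₀ ℕ => x none) he
    simp only [Finsupp.optionElim_apply_none] at h0
    rw [Finsupp.mapDomain_notin_range] at h0
    · exact h0.symm
    · simp

/-- Every `z`-slice of an element of `J κ⟦z,u⟧` lies in `J`. [folklore] -/
theorem coeff_optionEquivLeft_mem_of_mem_map (J : Ideal (MvPowerSeries (Fin n) κ))
    {x : MvPowerSeries (Option (Fin n)) κ}
    (hx : x ∈ J.map (rename (some : Fin n → Option (Fin n)) : MvPowerSeries (Fin n) κ →ₐ[κ] _)) (k : ℕ) :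
    PowerSeries.coeff k (optionEquivLeft x) ∈ J := by
  induction hx using Submodule.span_induction generalizing k with
  | mem y hy =>
    obtain ⟨g, hg, rfl⟩ := hy
    rw [optionEquivLeft_rename_some, PowerSeries.coeff_C]
    split_ifs
    · exact hg
    · exact J.zero_mem
  | zero => rw [map_zero, map_zero]; exact J.zero_mem
  | add y z _ _ hy hz => rw [map_add, map_add]; exact J.add_mem (hy k) (hz k)
  | smul b y _ hy =>
    rw [smul_eq_mul, map_mul, PowerSeries.coeff_mul]
    exact J.sum_mem fun ij _ => J.mul_mem_left _ (hy ij.2)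

/-- An exponent of `κ⟦z,u⟧` with a non-zero `z`-entry is not the placement of a `u`-exponent. [folklore] -/
theorem not_mem_range_mapDomain_some {e : Option (Fin n) →₀ ℕ} (h : e none ≠ 0) :
    e ∉ Set.range (Finsupp.mapDomain (some : Fin n → Option (Fin n))) := by
  rintro ⟨d, hd⟩
  apply h
  rw [← hd, Finsupp.mapDomain_notin_range]
  simp

/-! ## `Isol ⇒` the Tjurina algebra is finite -/

/-- Degree of an exponent of `κ⟦z,u⟧` = `z`-exponent + degree of the `u`-part. [folklore] -/
theorem degree_eq_none_add_degree_some (e : Option (Fin n) →₀ ℕ) : e.degree = e none + (e.some).degree := by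
  rw [Finsupp.degree_eq_sum, Finsupp.degree_eq_sum, Fintype.sum_option]
  rfl

/-- A monomial of `κ⟦z,u⟧` is `z^k` times a placed `u`-monomial. [folklore] -/
theorem monomial_eq_X_pow_mul_rename (e : Option (Fin n) →₀ ℕ) :
    (monomial e (1 : κ) : MvPowerSeries (Option (Fin n)) κ) =
      X none ^ (e none) * rename (some : Fin n → Option (Fin n)) (monomial e.some (1 : κ)) := by
  have hexp : Finsupp.single none (e none) + Finsupp.mapDomain (some : Fin n → Option (Fin n)) e.some = e := by
    ext o
    cases o with
    | none =>
      rw [Finsupp.add_apply, Finsupp.single_eq_same, Finsupp.mapDomain_notin_range, add_zero]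
      simp
    | some j =>
      rw [Finsupp.add_apply, Finsupp.single_eq_of_ne (Option.some_ne_none j), zero_add,
        Finsupp.mapDomain_apply (Option.some_injective _), Finsupp.some_apply]
  rw [rename_monomial, X_pow_eq, monomial_mul_monomial, one_mul, hexp]

/-- [OURS · L1 W4.6] **`Isol ⇒` finite Tjurina algebra.** If `κ⟦u⟧/jac c` is finite over `κ` then so is
`κ⟦z,u⟧/((z^p − ser c) + (jac c))`: a power of `𝔪̂` lies in the Tjurina ideal. [folklore] -/
theorem finite_tjurina_of_isol (c : (Fin n → ℕ) → κ) (hI : Isol p n κ c) :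
    Module.Finite κ (MvPowerSeries (Option (Fin n)) κ ⧸
      (Ideal.span {(X none : MvPowerSeries (Option (Fin n)) κ) ^ p -
          rename (some : Fin n → Option (Fin n)) (ser p n κ c)} ⊔
        (jac p n κ c).map (rename (some : Fin n → Option (Fin n)) : MvPowerSeries (Fin n) κ →ₐ[κ] _))) := by
  set T := Ideal.span {(X none : MvPowerSeries (Option (Fin n)) κ) ^ p -
          rename (some : Fin n → Option (Fin n)) (ser p n κ c)} ⊔
        (jac p n κ c).map (rename (some : Fin n → Option (Fin n)) : MvPowerSeries (Fin n) κ →ₐ[κ] _) with hT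
  haveI : Module.Finite κ (MvPowerSeries (Fin n) κ ⧸ jac p n κ c) := hI
  obtain ⟨N, hN⟩ := exists_maximalIdeal_pow_le_of_finite_quotient (jac p n κ c)
  have ha : ser p n κ c ∈ maximalIdeal (MvPowerSeries (Fin n) κ) :=
    mem_maximalIdeal_iff_constantCoeff_eq_zero.2 (constantCoeff_ser c)
  -- `z^{pN} ∈ T`
  have hzN : ((X none : MvPowerSeries (Option (Fin n)) κ) ^ p) ^ N ∈ T := by
    rw [← Ideal.Quotient.eq_zero_iff_mem, map_pow]
    have hz : Ideal.Quotient.mk T ((X none : MvPowerSeries (Option (Fin n)) κ) ^ p) =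
        Ideal.Quotient.mk T (rename (some : Fin n → Option (Fin n)) (ser p n κ c)) := by
      rw [Ideal.Quotient.eq]
      exact Ideal.mem_sup_left (Ideal.subset_span rfl)
    rw [hz, ← map_pow, ← map_pow, Ideal.Quotient.eq_zero_iff_mem]
    exact Ideal.mem_sup_right (Ideal.mem_map_of_mem _ (hN (Ideal.pow_mem_pow ha N)))
  have hle : maximalIdeal (MvPowerSeries (Option (Fin n)) κ) ^ (p * N + N) ≤ T := by
    rw [maximalIdeal_pow_eq_span_monomial, Ideal.span_le]
    rintro _ ⟨e, he, rfl⟩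
    change e.degree = p * N + N at he
    rw [SetLike.mem_coe]
    dsimp only
    rw [monomial_eq_X_pow_mul_rename]
    by_cases hs : N ≤ (e.some).degree
    · exact T.mul_mem_left _ (Ideal.mem_sup_right (Ideal.mem_map_of_mem _
        (hN (monomial_mem_maximalIdeal_pow hs 1))))
    · have hz : p * N ≤ e none := by
        have := degree_eq_none_add_degree_some e
        push Not at hs
        nlinarith
      rw [← Nat.sub_add_cancel hz, pow_add, pow_mul]
      exact T.mul_mem_right _ (T.mul_mem_left _ hzN)
  haveI := finite_quotient_maximalIdeal_pow (σ := Option (Fin n)) (K := κ) (p * N + N)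
  exact Module.Finite.of_surjective (Ideal.Quotient.factorₐ κ hle).toLinearMap
    (Ideal.Quotient.factor_surjective hle)

/-! ## Finite Tjurina algebra `⇒ Isol`: the Tjurina ideal contracts to `jac` -/

/-- **Krull, in the form used**: in `κ⟦u⟧`, an element lying in `J + 𝔪^N` for every `N` lies in `J`.
[folklore] -/
theorem mem_of_forall_mem_sup_pow {J : Ideal (MvPowerSeries (Fin n) κ)} {x : MvPowerSeries (Fin n) κ}
    (h : ∀ N, x ∈ J ⊔ maximalIdeal (MvPowerSeries (Fin n) κ) ^ N) : x ∈ J := by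
  by_cases hJ : J = ⊤
  · rw [hJ]; exact Submodule.mem_top
  haveI : Nontrivial (MvPowerSeries (Fin n) κ ⧸ J) := Ideal.Quotient.nontrivial_iff.mpr hJ
  haveI : IsNoetherianRing (MvPowerSeries (Fin n) κ) :=
    Literature.AlgebraicGeometry.Resolution.isNoetherianRing_mvPowerSeries κ (Fin n)
  haveI : IsLocalRing (MvPowerSeries (Fin n) κ ⧸ J) :=
    IsLocalRing.of_surjective' (Ideal.Quotient.mk J) Ideal.Quotient.mk_surjective
  set M := (maximalIdeal (MvPowerSeries (Fin n) κ)).map (Ideal.Quotient.mk J) with hM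
  have hMtop : M ≠ ⊤ := by
    intro htop
    have h1 := Ideal.comap_map_of_surjective (Ideal.Quotient.mk J) Ideal.Quotient.mk_surjective
      (maximalIdeal (MvPowerSeries (Fin n) κ))
    rw [← hM, htop, Ideal.comap_top, ← RingHom.ker_eq_comap_bot, Ideal.mk_ker,
      sup_eq_left.2 (IsLocalRing.le_maximalIdeal hJ)] at h1
    exact IsLocalRing.maximalIdeal.isMaximal _ |>.ne_top h1.symm
  have hK := Ideal.iInf_pow_eq_bot_of_isLocalRing (I := M) hMtop
  rw [← Ideal.Quotient.eq_zero_iff_mem, ← Ideal.mem_bot, ← hK, Ideal.mem_iInf]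
  intro N
  have hmap : (J ⊔ maximalIdeal (MvPowerSeries (Fin n) κ) ^ N).map (Ideal.Quotient.mk J) =
      (maximalIdeal (MvPowerSeries (Fin n) κ) ^ N).map (Ideal.Quotient.mk J) := by
    rw [Ideal.map_sup, Ideal.map_quotient_self, bot_sup_eq]
  rw [hM, ← Ideal.map_pow, ← hmap]
  exact Ideal.mem_map_of_mem _ (h N)

/-- [OURS · L1 W4.6] **The Tjurina ideal of the atom contracts to the Jacobian ideal**: for `p ≠ 0`,
`((z^p − ser c) + (jac c) κ⟦z,u⟧) ∩ κ⟦u⟧ = jac c`. Slicing + Krull (module docstring). [folklore] -/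
theorem comap_tjurina_eq [Fact p.Prime] (c : (Fin n → ℕ) → κ) :
    (Ideal.span {(X none : MvPowerSeries (Option (Fin n)) κ) ^ p -
          rename (some : Fin n → Option (Fin n)) (ser p n κ c)} ⊔
        (jac p n κ c).map (rename (some : Fin n → Option (Fin n)) : MvPowerSeries (Fin n) κ →ₐ[κ] _)).comap
      (rename (some : Fin n → Option (Fin n)) : MvPowerSeries (Fin n) κ →ₐ[κ] _) = jac p n κ c := by
  have hp : p ≠ 0 := (Fact.out : p.Prime).ne_zero
  set a := ser p n κ c with ha_def
  set J := jac p n κ c with hJ_def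
  apply le_antisymm
  · intro g hg
    rw [Ideal.mem_comap, Ideal.mem_span_singleton_sup] at hg
    obtain ⟨h, j, hj, hEq⟩ := hg
    have hjk := coeff_optionEquivLeft_mem_of_mem_map J hj
    -- apply the slicing isomorphism
    have hEq' : optionEquivLeft h * (PowerSeries.X ^ p - PowerSeries.C a) + optionEquivLeft j =
        PowerSeries.C g := by
      have := congrArg optionEquivLeft hEq
      rwa [map_add, map_mul, map_sub, map_pow, optionEquivLeft_X_none, optionEquivLeft_rename_some,
        optionEquivLeft_rename_some] at this
    set H := optionEquivLeft h with hH_def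
    set j' := optionEquivLeft j with hj'_def
    -- the `z^k`-slices of the relation
    have hrec : ∀ k, (if p ≤ k then PowerSeries.coeff (k - p) H else 0) - PowerSeries.coeff k H * a +
        PowerSeries.coeff k j' = if k = 0 then g else 0 := by
      intro k
      have := congrArg (PowerSeries.coeff k) hEq'
      rwa [map_add, mul_sub, map_sub, PowerSeries.coeff_mul_X_pow', PowerSeries.coeff_mul_C,
        PowerSeries.coeff_C] at this
    -- one step of the recursion: `H_m ≡ a H_{m+p}` modulo `J`
    have hstep : ∀ m, PowerSeries.coeff m H - a * PowerSeries.coeff (m + p) H ∈ J := by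
      intro m
      have h1 := hrec (m + p)
      rw [if_pos (Nat.le_add_left p m), Nat.add_sub_cancel, if_neg (by omega : m + p ≠ 0)] at h1
      have h2 : PowerSeries.coeff m H - a * PowerSeries.coeff (m + p) H = -PowerSeries.coeff (m + p) j' := by
        rw [← sub_eq_zero, ← h1]; ring
      rw [h2]
      exact J.neg_mem_iff.2 (hjk (m + p))
    -- iterate: `H_m ≡ a^N H_{m+Np}` modulo `J`
    have hiter : ∀ N m, PowerSeries.coeff m H - a ^ N * PowerSeries.coeff (m + N * p) H ∈ J := by
      intro N
      induction N with
      | zero => intro m; simp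
      | succ N ih =>
        intro m
        have e1 := ih m
        have e2 := hstep (m + N * p)
        have e3 : PowerSeries.coeff m H - a ^ (N + 1) * PowerSeries.coeff (m + (N + 1) * p) H =
            (PowerSeries.coeff m H - a ^ N * PowerSeries.coeff (m + N * p) H) +
              a ^ N * (PowerSeries.coeff (m + N * p) H - a * PowerSeries.coeff (m + N * p + p) H) := by
          rw [show m + (N + 1) * p = m + N * p + p by ring]
          ring
        rw [e3]
        exact J.add_mem e1 (J.mul_mem_left _ e2)
    -- Krull: every slice of `H` lies in `J`
    have ha : a ∈ maximalIdeal (MvPowerSeries (Fin n) κ) :=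
      mem_maximalIdeal_iff_constantCoeff_eq_zero.2 (constantCoeff_ser c)
    have hH : ∀ m, PowerSeries.coeff m H ∈ J := by
      intro m
      refine mem_of_forall_mem_sup_pow fun N => ?_
      have e : PowerSeries.coeff m H = (PowerSeries.coeff m H - a ^ N * PowerSeries.coeff (m + N * p) H) +
          a ^ N * PowerSeries.coeff (m + N * p) H := by ring
      rw [e]
      exact Submodule.add_mem_sup (hiter N m) (Ideal.mul_mem_right _ _ (Ideal.pow_mem_pow ha N))
    -- the `z^0`-slice: `g = −a H_0 + j_0 ∈ J`
    have h0 := hrec 0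
    rw [if_neg (by omega : ¬ p ≤ 0), if_pos rfl] at h0
    rw [← h0]
    exact J.add_mem (J.sub_mem J.zero_mem (J.mul_mem_right _ (hH 0))) (hjk 0)
  · intro g hg
    exact Ideal.mem_sup_right (Ideal.mem_map_of_mem _ hg)

/-- [OURS · L1 W4.6] **Finite Tjurina algebra `⇒ Isol`**: `κ⟦u⟧/jac c` embeds `κ`-linearly into the Tjurina
algebra (`comap_tjurina_eq`), so it is finite when the latter is. [folklore] -/
theorem isol_of_finite_tjurina [Fact p.Prime] (c : (Fin n → ℕ) → κ)
    (hT : Module.Finite κ (MvPowerSeries (Option (Fin n)) κ ⧸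
      (Ideal.span {(X none : MvPowerSeries (Option (Fin n)) κ) ^ p -
          rename (some : Fin n → Option (Fin n)) (ser p n κ c)} ⊔
        (jac p n κ c).map (rename (some : Fin n → Option (Fin n)) : MvPowerSeries (Fin n) κ →ₐ[κ] _)))) :
    Isol p n κ c := by
  have hcomap := comap_tjurina_eq (κ := κ) (p := p) c
  haveI := hT
  have hinj : Function.Injective (Ideal.quotientMapₐ (Ideal.span {(X none : MvPowerSeries (Option (Fin n)) κ) ^ p -
          rename (some : Fin n → Option (Fin n)) (ser p n κ c)} ⊔
        (jac p n κ c).map (rename (some : Fin n → Option (Fin n)) : MvPowerSeries (Fin n) κ →ₐ[κ] _))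
      (rename (some : Fin n → Option (Fin n)) : MvPowerSeries (Fin n) κ →ₐ[κ] _) (le_of_eq hcomap.symm)) := by
    rw [injective_iff_map_eq_zero]
    intro x hx
    obtain ⟨x, rfl⟩ := Ideal.Quotient.mk_surjective x
    rw [Ideal.quotient_map_mkₐ] at hx
    change Ideal.Quotient.mk _ _ = 0 at hx
    rw [Ideal.Quotient.eq_zero_iff_mem] at hx
    rw [Ideal.Quotient.eq_zero_iff_mem, ← hcomap, Ideal.mem_comap]
    exact hx
  exact Module.Finite.of_injective (Ideal.quotientMapₐ _ _ (le_of_eq hcomap.symm)).toLinearMap hinj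

/-- [OURS · L1 W4.6 — DICTIONARY: the isolatedness predicate; replaces the role of «`Sing(E)` is a finite set of
closed points / the singularity of `z^p = a(u)` at `ξ` is ISOLATED» for the atom on the completed local ring
(cf. H. Hironaka, ms. 2017, §2.1 p.4, Def. 15.12 p.80 — role only); NOT a statement of the manuscript]
**`Isol c` ⟺ the Tjurina algebra `κ⟦z,u⟧/((z^p − ser c) + (jac c))` is finite over `κ`.** [folklore] -/
theorem isol_iff_finite_tjurina [Fact p.Prime] (c : (Fin n → ℕ) → κ) :
    Isol p n κ c ↔ Module.Finite κ (MvPowerSeries (Option (Fin n)) κ ⧸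
      (Ideal.span {(X none : MvPowerSeries (Option (Fin n)) κ) ^ p -
          rename (some : Fin n → Option (Fin n)) (ser p n κ c)} ⊔
        (jac p n κ c).map (rename (some : Fin n → Option (Fin n)) : MvPowerSeries (Fin n) κ →ₐ[κ] _))) :=
  ⟨finite_tjurina_of_isol c, isol_of_finite_tjurina c⟩

end CampaignW46.AtomGerm

end Summit.ResolutionOfSingularities.ResolutionOfSingularities.Theorems

end
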